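import Literature.MathematicalPhysics.QuantumFieldTheory.Balaban1983to89.B15Prop1Carrier

/-!
# `Balaban1983to89.B15Prop1SliceCoordinates` — T. Bałaban, *Large field renormalization. II. Localization, exponentiation, and
bounds for the 𝐑 operation*, Commun. Math. Phys. **122** (1989) 355–392 [Balaban1989LargeFieldII] («[LF-II]»), p. 359: *«Denote by
P₀ the projection onto the subspace of B′ satisfying the gauge condition B′↾_{G₀} = 0»* — THE GAUGE-FIXED COORDINATE SPACE OF THE
PROPOSITION-1 CHART AS A CONCRETE HILBERT SPACE: the `𝔤`-valued functions on the FREE BONDS (the bonds meeting `Λ^{(k)}` off the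
tree `G₀`) with the `ℓ²` inner product, its extension-by-zero `ιA` to bond fields, and the three COORDINATE FACTS (ι1)–(ι3) that
dag-n12-c's assembly `B15Prop1CarrierOnFromLetters.prop1Printed_lfVarOn_of_letters` displays as hypotheses — PROVED here, so that
at this choice of `E i` (with `P₀ = id`: the gauge condition is solved by the coordinates) they are no longer letters.

statement-level skeleton of published theorems with citation tags; proofs where landed; nothing here is a claim about
the Yang–Mills mass gap

Cell pub-ymgap, HUMAN RULING D-0062 (Track A full width), seat `pub-ymgap-dag-n12-c` (R134 acceleration seat (a), strategy s1
of DAG node N12 = [B15]; generation g2, sixth product).  PDF held: `paper:balaban1989-cmp122-large-field-ii` (journal page = PDF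
page + 354; p. 359 = PDF 5).

THE PRINT (p. 359): *«Fixing the gauge G₀ for V′ we get a small configuration, and we can write V′ = exp iB′. … Denote by P₀
the projection onto the subspace of B′ satisfying the gauge condition B′↾_{G₀} = 0. By the inequality (1.9) the operator
P₀H*_{1,k}Δ₁H_{1,k}P₀ is positive, hence invertible on this subspace»*; p. 357 (1.2): *«∫dB′↾_Λ δ_{G₀}(B′) …»* — the integration ∕
variational variables are the values `B′(b) ∈ 𝔤` on the bonds of the variables off `G₀`.

WHAT THIS FILE PROVES (Mathlib + `B15Prop1Carrier`; no `sorry`, no `… : Prop` fact, no `instance`, no `notation`; the `def`s are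
OBJECTS with bodies; axioms standard).  §1 `freeBonds S T` (the bonds meeting `S` off `T`, a `Finset`), `mem_freeBonds`;
`GaugeSlice S T 𝔤 := PiLp 2 (fun _ : freeBonds S T => 𝔤)` — *«the subspace of B′ satisfying the gauge condition»* as its own
finite-dimensional real inner-product space (Mathlib's `PiLp` instances); `ιA S T : GaugeSlice S T 𝔤 →ₗ[ℝ] VecField P k 𝔤` (extension by
zero), `ιA_apply_of_mem`, `ιA_apply_of_not_mem`.  §2 THE COORDINATE FACTS: (ι1) `isSupportedOn_ιA` (`ιA B` is supported on the free
bonds); (ι3) `norm_ιA_apply_le` (`‖ιA B (b)‖ ≤ ‖B‖`); (ι2) `exists_slice_eq` (every bond field supported on the free bonds with values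
of norm `≤ t` is `ιA B` with `‖B‖ ≤ √|free bonds| · t`); and the three in the LITERAL shape of `prop1Printed_lfVarOn_of_letters`'s
hypotheses `hι1`/`hι2`/`hι3` at `P₀ := LinearMap.id` (`coord_ι1`, `coord_ι2`, `coord_ι3`).

HONEST SCOPE.  (i) This is bookkeeping: the identification of the model's abstract `E i` with a concrete coordinate space; with
`P₀ = id` the model's positivity letter (m1) is asked on the whole slice, which is what (1.9) prints (*«on the fields B′ … equal
to 0 on bonds of the graph G₀»*).  (ii) The norm is `ℓ²` over bonds of the `𝔤`-norm (print's `‖B′‖` in (1.8)–(1.9)); the constant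
`√|free bonds|` converts a uniform (sup) bound into it.  (iii) `T` is any bond set (print: `G₀`).  Count-neutral; NOT a discharge
of N12; NOT summit progress.
-/

noncomputable section

open Set

namespace Literature.MathematicalPhysics.QuantumFieldTheory.Balaban1983to89.B15Prop1SliceCoordinates

open B15DeterminingSets GaugeField B15Prop1Carrier

variable {P : Params} {k : ℕ} [DecidableEq (PBond P k)]

/-! ## §1 The free bonds, the slice, the extension by zero -/

open Classical in
/-- THE FREE BONDS of the chart: the bonds meeting `S = Λ^{(k)}` (the variables of (1.77)) that are NOT in the tree `T = G₀` (there
`B′ = 0`). [cite: Balaban1989LargeFieldII, p.359 («B′ satisfying the gauge condition B′↾_{G₀} = 0»)] -/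
def freeBonds (S : Set (Site P k)) (T : Finset (PBond P k)) : Finset (PBond P k) :=
  Finset.univ.filter fun b => b ∈ bondsOf S ∧ b ∉ T

/-- Membership in the free bonds. [cite: Balaban1989LargeFieldII, p.359] -/
theorem mem_freeBonds {S : Set (Site P k)} {T : Finset (PBond P k)} {b : PBond P k} :
    b ∈ freeBonds S T ↔ b ∈ bondsOf S ∧ b ∉ T := by
  simp [freeBonds]

/-- **THE GAUGE-FIXED COORDINATE SPACE** (*«the subspace of B′ satisfying the gauge condition B′↾_{G₀} = 0»*): `𝔤`-valued
functions on the free bonds with the `ℓ²` inner product — a finite-dimensional real inner-product space by Mathlib's `PiLp`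
instances whenever `𝔤` is one. [cite: Balaban1989LargeFieldII, p.359] -/
abbrev GaugeSlice (S : Set (Site P k)) (T : Finset (PBond P k)) (𝔤 : Type*) : Type _ :=
  PiLp 2 (fun _ : ↥(freeBonds S T) => 𝔤)

variable {𝔤 : Type*} [NormedAddCommGroup 𝔤] [InnerProductSpace ℝ 𝔤]

/-- **EXTENSION BY ZERO** `ιA : GaugeSlice → (bonds → 𝔤)`: the bond field `B′` of a coordinate vector (its value on the free bonds, `0`
on `G₀` and off the bonds meeting `Λ^{(k)}`), a linear map. [cite: Balaban1989LargeFieldII, p.359] -/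
def ιA (S : Set (Site P k)) (T : Finset (PBond P k)) : GaugeSlice S T 𝔤 →ₗ[ℝ] VecField P k 𝔤 where
  toFun B b := if h : b ∈ freeBonds S T then B ⟨b, h⟩ else 0
  map_add' B B' := by
    funext b
    by_cases h : b ∈ freeBonds S T
    · simp only [dif_pos h, Pi.add_apply, PiLp.add_apply]
    · simp only [dif_neg h, Pi.add_apply, add_zero]
  map_smul' c B := by
    funext b
    by_cases h : b ∈ freeBonds S T
    · simp only [dif_pos h, Pi.smul_apply, PiLp.smul_apply, RingHom.id_apply]
    · simp only [dif_neg h, Pi.smul_apply, smul_zero, RingHom.id_apply]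

/-- `ιA B` on a free bond is the coordinate. [cite: Balaban1989LargeFieldII, p.359] -/
theorem ιA_apply_of_mem {S : Set (Site P k)} {T : Finset (PBond P k)} (B : GaugeSlice S T 𝔤) {b : PBond P k}
    (h : b ∈ freeBonds S T) : ιA S T B b = B ⟨b, h⟩ := by
  show (if h : b ∈ freeBonds S T then B ⟨b, h⟩ else 0) = B ⟨b, h⟩
  rw [dif_pos h]

/-- `ιA B = 0` off the free bonds (on `G₀` and off the variables). [cite: Balaban1989LargeFieldII, p.359] -/
theorem ιA_apply_of_not_mem {S : Set (Site P k)} {T : Finset (PBond P k)} (B : GaugeSlice S T 𝔤) {b : PBond P k}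
    (h : b ∉ freeBonds S T) : ιA S T B b = 0 := by
  show (if h : b ∈ freeBonds S T then B ⟨b, h⟩ else 0) = 0
  rw [dif_neg h]

/-! ## §2 The coordinate facts (ι1)–(ι3) -/

/-- **(ι1)** `ιA B` is supported on the free bonds `{b ∈ bondsOf S | b ∉ T}`. [cite: Balaban1989LargeFieldII, p.359] -/
theorem isSupportedOn_ιA {S : Set (Site P k)} {T : Finset (PBond P k)} (B : GaugeSlice S T 𝔤) :
    IsSupportedOn {b | b ∈ bondsOf S ∧ b ∉ T} (ιA S T B) := fun _ hb =>
  ιA_apply_of_not_mem B fun h => hb (mem_freeBonds.1 h)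

/-- **(ι3)** every coordinate is dominated by the `ℓ²` norm: `‖ιA B (b)‖ ≤ ‖B‖`. [cite: Balaban1989LargeFieldII, (1.8)–(1.9) p.358] -/
theorem norm_ιA_apply_le {S : Set (Site P k)} {T : Finset (PBond P k)} (B : GaugeSlice S T 𝔤) (b : PBond P k) :
    ‖ιA S T B b‖ ≤ ‖B‖ := by
  by_cases h : b ∈ freeBonds S T
  · rw [ιA_apply_of_mem B h]
    exact PiLp.norm_apply_le B ⟨b, h⟩
  · rw [ιA_apply_of_not_mem B h, norm_zero]
    exact norm_nonneg _

omit [DecidableEq (PBond P k)] in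
/-- The bond type is inhabited (`d ≥ 1`). [folklore] -/
private theorem pbond_nonempty : Nonempty (PBond P k) := ⟨⟨default, ⟨0, P.hd⟩⟩⟩

/-- **(ι2)** every bond field supported on the free bonds whose values have norm `≤ t` is the extension by zero of a coordinate
vector of norm `≤ √|free bonds| · t` (sup-to-`ℓ²` conversion on a finite set). [cite: Balaban1989LargeFieldII, (1.8) p.358, p.359] -/
theorem exists_slice_eq {S : Set (Site P k)} {T : Finset (PBond P k)} {A : VecField P k 𝔤}
    (hA : IsSupportedOn {b | b ∈ bondsOf S ∧ b ∉ T} A) {t : ℝ} (ht : ∀ b, ‖A b‖ ≤ t) :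
    ∃ B : GaugeSlice S T 𝔤, ιA S T B = A ∧ ‖B‖ ≤ Real.sqrt (freeBonds S T).card * t := by
  obtain ⟨b₀⟩ := (pbond_nonempty : Nonempty (PBond P k))
  have ht0 : 0 ≤ t := (norm_nonneg _).trans (ht b₀)
  refine ⟨WithLp.toLp 2 fun i : ↥(freeBonds S T) => A i.1, ?_, ?_⟩
  · funext b
    by_cases h : b ∈ freeBonds S T
    · rw [ιA_apply_of_mem _ h]
    · rw [ιA_apply_of_not_mem _ h]
      exact (hA b fun hb => h (mem_freeBonds.2 hb)).symm
  · set B : GaugeSlice S T 𝔤 := WithLp.toLp 2 fun i : ↥(freeBonds S T) => A i.1 with hB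
    have hsq : ‖B‖ ^ 2 ≤ (Real.sqrt (freeBonds S T).card * t) ^ 2 := by
      rw [PiLp.norm_sq_eq_of_L2, mul_pow, Real.sq_sqrt (Nat.cast_nonneg _)]
      calc ∑ i : ↥(freeBonds S T), ‖B i‖ ^ 2 ≤ ∑ _i : ↥(freeBonds S T), t ^ 2 :=
            Finset.sum_le_sum fun i _ => by
              have h1 : ‖B i‖ ≤ t := ht i.1
              exact pow_le_pow_left₀ (norm_nonneg _) h1 2
        _ = (freeBonds S T).card * t ^ 2 := by simp [Finset.sum_const]
    exact (pow_le_pow_iff_left₀ (norm_nonneg _) (by positivity) two_ne_zero).1 hsq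

/-! ## §3 The coordinate facts in the literal shape of `prop1Printed_lfVarOn_of_letters` (`P₀ := id`) -/

/-- (ι1) literally: for `B` in the range of `P₀ = id`, `ιA B` is supported on the free bonds. [cite: Balaban1989LargeFieldII, p.359] -/
theorem coord_ι1 (S : Set (Site P k)) (T : Finset (PBond P k)) :
    ∀ B : GaugeSlice S T 𝔤, (LinearMap.id : GaugeSlice S T 𝔤 →ₗ[ℝ] GaugeSlice S T 𝔤) B = B →
      IsSupportedOn {b | b ∈ bondsOf S ∧ b ∉ T} (ιA S T B) :=
  fun B _ => isSupportedOn_ιA B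

/-- (ι2) literally, with `N = √|free bonds|`. [cite: Balaban1989LargeFieldII, p.359] -/
theorem coord_ι2 (S : Set (Site P k)) (T : Finset (PBond P k)) :
    ∀ (A : VecField P k 𝔤) (t : ℝ), IsSupportedOn {b | b ∈ bondsOf S ∧ b ∉ T} A → (∀ b, ‖A b‖ ≤ t) →
      ∃ B : GaugeSlice S T 𝔤, (LinearMap.id : GaugeSlice S T 𝔤 →ₗ[ℝ] GaugeSlice S T 𝔤) B = B ∧ ιA S T B = A ∧
        ‖B‖ ≤ Real.sqrt (freeBonds S T).card * t := by
  intro A t hA ht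
  obtain ⟨B, hB, hBn⟩ := exists_slice_eq hA ht
  exact ⟨B, rfl, hB, hBn⟩

/-- (ι3) literally. [cite: Balaban1989LargeFieldII, (1.8)–(1.9) p.358] -/
theorem coord_ι3 (S : Set (Site P k)) (T : Finset (PBond P k)) :
    ∀ (B : GaugeSlice S T 𝔤) (b : PBond P k), ‖ιA S T B b‖ ≤ ‖B‖ :=
  fun B b => norm_ιA_apply_le B b

end Literature.MathematicalPhysics.QuantumFieldTheory.Balaban1983to89.B15Prop1SliceCoordinates

end
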